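import Literature.NumberTheory.ModularForms.DedekindSumReciprocity
import Mathlib.LinearAlgebra.Matrix.FixedDetMatrices
import HarnessLib

/-!
# Rademacher's `Φ` under the generators of `SL₂(ℤ)` and the composition law (proved)

Topic `Literature/NumberTheory/ModularForms`; namespace `Literature.NumberTheory.ModularForms`.
Theorem-only sequel of `DedekindSumRademacherPhi` / `DedekindSumReciprocity`: no new definitions, no
named facts; it DISCHARGES the named statement `RademacherPhiComposition` of `DedekindSumRademacherPhi`
(net debt −1).

* `rademacherPhi_neg` — `Φ(−M) = Φ(M)`; `rademacherPhi_mul_T` — `Φ(MT) = Φ(M) + 1`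
  (Apostol, supplement to Ch. 3, Lemma 1: `ε(AT^m) = e^{πim/12} ε(A)`, i.e. `s(cm + d, c) = s(d, c)`);
  **`rademacherPhi_mul_S`** — `Φ(MS) = Φ(M) − 3·sign(cd)` for `S = (0 −1; 1 0)` (Apostol, loc. cit.,
  Lemma 2: `ε(AS) = e^{∓πi/4} ε(A)` according as `d > 0` / `d < 0`, from the RECIPROCITY LAW — here
  `dedekindSum_reciprocity`, proved in `DedekindSumReciprocity`); `SL(2, ℤ)` versions
  `rademacherPhiSL_neg/_mul_T/_mul_T_inv/_mul_S`.
* **`RademacherPhiComposition_holds`** — the COMPOSITION LAW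
  `Φ(M'M) = Φ(M') + Φ(M) − 3·sign(c c' c'')` [cite: RademacherGrosswald1972, Ch. 4 A, eq. (62)].
  The printed proof (pp. 50–51) compares the two values of `log η(M'Mτ)` given by the transformation
  formula (60) of `log η`; the book remarks that purely arithmetic proofs exist (refs. [40], [32]
  there) but are lengthy.  We give a short arithmetic proof: induction over words in the generators
  `S`, `T` of `SL₂(ℤ)` (`Subgroup.closure_induction_right`) applied to the right factor `M`; the step
  `M ↦ MT^{±1}` is `rademacherPhi_mul_T`, and the step `M ↦ MS^{±1}` is `rademacherPhi_mul_S` together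
  with the elementary SIGN IDENTITY `sign(cd) + sign(c'·d·d'') = sign(c''d'') + sign(c·c'·c'')` for
  `(c'', d'') = (c', d')·M` (`sign_identity_of_det`, from `c''d − d''c = c'`).
* Hypothesis-free forms of the in-tree consequences: `eisensteinPsiSL_mul'`,
  `eisensteinPsiSL_mul_of_mem_Gamma0'` (`Ψ_t` is a homomorphism on `Γ₀(t)`).

## References

* [Apostol1990] T. M. Apostol, *Modular Functions and Dirichlet Series in Number Theory*, 2nd ed.,
  GTM 41 (1990): supplement to Ch. 3, "Alternate proof of Dedekind's functional equation", Lemmas 1–2;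
  Thm. 3.6(a) (periodicity/oddness), Thm. 3.7 (reciprocity).
* [RademacherGrosswald1972] H. Rademacher, E. Grosswald, *Dedekind Sums*, Carus Math. Monographs 16
  (1972), Ch. 4 A, eq. (59) (definition of `Φ`), eq. (62) (composition law), pp. 49–51.
-/

open scoped MatrixGroups

namespace Literature.NumberTheory.ModularForms

/-! ### Signs and absolute values in the first argument of `s(h,k)` -/

/-- `s(h, k) = sign(h)·s(|h|, k)` (oddness, eq. (33a)). [cite: RademacherGrosswald1972, Ch. 3 eq. (33a)] -/
theorem dedekindSum_eq_sign_mul_natAbs (h : ℤ) (k : ℕ) :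
    dedekindSum h k = (Int.sign h : ℚ) * dedekindSum (h.natAbs : ℤ) k := by
  rcases lt_trichotomy h 0 with hh | rfl | hh
  · rw [Int.sign_eq_neg_one_of_neg hh, show ((h.natAbs : ℕ) : ℤ) = -h from by omega, dedekindSum_neg]
    push_cast; ring
  · simp
  · rw [Int.sign_eq_one_of_pos hh, show ((h.natAbs : ℕ) : ℤ) = h from by omega]
    push_cast; ring

/-- In `SL₂(ℤ)` the lower row is coprime: `gcd(|c|, |d|) = 1`. [folklore] -/
private theorem natAbs_coprime_of_det {a b c d : ℤ} (hdet : a * d - b * c = 1) :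
    Nat.Coprime c.natAbs d.natAbs := by
  have h : IsCoprime c d := ⟨-b, a, by linear_combination hdet⟩
  rw [Int.isCoprime_iff_gcd_eq_one] at h
  rwa [Int.gcd_eq_natAbs] at h

/-! ### `Φ(−M) = Φ(M)` and the step `M ↦ MT` (Apostol, Lemma 1) -/

/-- **`Φ(−M) = Φ(M)`**: `Φ` is a function of the modular substitution, not of the matrix.
[cite: RademacherGrosswald1972, Ch. 4 A, eq. (59)] -/
theorem rademacherPhi_neg (a b c d : ℤ) :
    rademacherPhi (-a) (-b) (-c) (-d) = rademacherPhi a b c d := by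
  by_cases hc : c = 0
  · subst hc
    rw [neg_zero, rademacherPhi_of_c_eq_zero, rademacherPhi_of_c_eq_zero]
    push_cast
    rw [neg_div_neg_eq]
  · rw [rademacherPhi_of_c_ne_zero hc, rademacherPhi_of_c_ne_zero (neg_ne_zero.mpr hc),
      Int.sign_neg, Int.natAbs_neg, dedekindSum_neg]
    push_cast
    rw [show (-(a : ℚ) + -(d : ℚ)) / -(c : ℚ) = ((a : ℚ) + d) / c from by
      rw [← neg_add, neg_div_neg_eq]]
    ring

/-- **Apostol's Lemma 1** in terms of `Φ`: `Φ(MT) = Φ(M) + 1` for `M = (a b; c d)`, `ad − bc = 1`,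
`MT = (a, a + b; c, c + d)` — by the periodicity `s(c + d, |c|) = s(d, |c|)`.
[cite: Apostol1990, Supplement to Ch. 3, Lemma 1] -/
theorem rademacherPhi_mul_T {a b c d : ℤ} (hdet : a * d - b * c = 1) :
    rademacherPhi a (a + b) c (c + d) = rademacherPhi a b c d + 1 := by
  by_cases hc : c = 0
  · subst hc
    rw [rademacherPhi_of_c_eq_zero, rademacherPhi_of_c_eq_zero]
    have had : a * d = 1 := by linarith
    have hd : (d : ℚ) ≠ 0 := by
      have : d ≠ 0 := by rintro rfl; simp at had
      exact_mod_cast this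
    rcases Int.eq_one_or_neg_one_of_mul_eq_one had with rfl | rfl
    · have : d = 1 := by linarith
      subst this; push_cast; field_simp; ring
    · have : d = -1 := by linarith
      subst this; push_cast; field_simp; ring
  · rw [rademacherPhi_of_c_ne_zero hc, rademacherPhi_of_c_ne_zero hc]
    have hper : dedekindSum (c + d) c.natAbs = dedekindSum d c.natAbs := by
      rw [show c + d = d + Int.sign c * (c.natAbs : ℕ) from by rw [Int.sign_mul_natAbs]; ring,
        dedekindSum_add_mul]
    rw [hper]
    have hc' : (c : ℚ) ≠ 0 := by exact_mod_cast hc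
    push_cast
    field_simp
    ring

/-- `Φ(MT⁻¹) = Φ(M) − 1`, `MT⁻¹ = (a, b − a; c, d − c)`. [cite: Apostol1990, Supplement to Ch. 3, Lemma 1] -/
theorem rademacherPhi_mul_T_inv {a b c d : ℤ} (hdet : a * d - b * c = 1) :
    rademacherPhi a (b - a) c (d - c) = rademacherPhi a b c d - 1 := by
  have h := rademacherPhi_mul_T (a := a) (b := b - a) (c := c) (d := d - c) (by linear_combination hdet)
  rw [show a + (b - a) = b from by ring, show c + (d - c) = d from by ring] at h
  linarith

/-! ### The step `M ↦ MS` (Apostol, Lemma 2, from the reciprocity law) -/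

/-- Apostol's Lemma 2, case `c > 0`, `d > 0`: `Φ(MS) = Φ(M) − 3`, `MS = (b, −a; d, −c)`; the
reciprocity law with `1 = ad − bc` in the numerator. [cite: Apostol1990, Supplement to Ch. 3, Lemma 2] -/
private theorem rademacherPhi_mul_S_of_pos_of_pos {a b c d : ℤ} (hdet : a * d - b * c = 1)
    (hc : 0 < c) (hd : 0 < d) :
    rademacherPhi b (-a) d (-c) = rademacherPhi a b c d - 3 := by
  obtain ⟨C, rfl⟩ := Int.eq_ofNat_of_zero_le hc.le
  obtain ⟨D, rfl⟩ := Int.eq_ofNat_of_zero_le hd.le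
  have hC : 0 < C := by exact_mod_cast hc
  have hD : 0 < D := by exact_mod_cast hd
  have hcop : Nat.Coprime C D := by simpa using natAbs_coprime_of_det hdet
  have R := dedekindSum_reciprocity hC hD hcop
  rw [rademacherPhi_of_c_ne_zero (by exact_mod_cast hD.ne'),
    rademacherPhi_of_c_ne_zero (by exact_mod_cast hC.ne'), Int.natAbs_natCast, Int.natAbs_natCast,
    dedekindSum_neg, Int.sign_natCast_of_ne_zero hC.ne', Int.sign_natCast_of_ne_zero hD.ne']
  have hC' : (C : ℚ) ≠ 0 := by exact_mod_cast hC.ne'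
  have hD' : (D : ℚ) ≠ 0 := by exact_mod_cast hD.ne'
  have hdet' : (a : ℚ) * D - b * C = 1 := by exact_mod_cast hdet
  push_cast
  field_simp
  linear_combination R - hdet'

/-- Apostol's Lemma 2, case `c > 0`, `d < 0`: `Φ(MS) = Φ(M) + 3` (with the representative
`(−b, a; −d, c)` of `MS`, which has the same `Φ`). [cite: Apostol1990, Supplement to Ch. 3, Lemma 2] -/
private theorem rademacherPhi_mul_S_of_pos_of_neg {a b c d : ℤ} (hdet : a * d - b * c = 1)
    (hc : 0 < c) (hd : d < 0) :
    rademacherPhi b (-a) d (-c) = rademacherPhi a b c d + 3 := by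
  obtain ⟨C, rfl⟩ := Int.eq_ofNat_of_zero_le hc.le
  obtain ⟨D, hD0⟩ := Int.eq_ofNat_of_zero_le (neg_nonneg.mpr hd.le)
  have hdD : d = -(D : ℤ) := by linarith
  subst hdD
  have hC : 0 < C := by exact_mod_cast hc
  have hD : 0 < D := by
    have : (0 : ℤ) < D := by linarith
    exact_mod_cast this
  have hcop : Nat.Coprime C D := by simpa using natAbs_coprime_of_det hdet
  have R := dedekindSum_reciprocity hC hD hcop
  rw [rademacherPhi_of_c_ne_zero (show (-(D : ℤ)) ≠ 0 from neg_ne_zero.mpr (by exact_mod_cast hD.ne')),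
    rademacherPhi_of_c_ne_zero (by exact_mod_cast hC.ne'), Int.natAbs_neg, Int.natAbs_natCast,
    Int.natAbs_natCast, dedekindSum_neg, dedekindSum_neg, Int.sign_neg,
    Int.sign_natCast_of_ne_zero hC.ne', Int.sign_natCast_of_ne_zero hD.ne']
  have hC' : (C : ℚ) ≠ 0 := by exact_mod_cast hC.ne'
  have hD' : (D : ℚ) ≠ 0 := by exact_mod_cast hD.ne'
  have hdet' : (a : ℚ) * (-(D : ℚ)) - b * C = 1 := by exact_mod_cast hdet
  push_cast
  field_simp
  linear_combination -R + hdet'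

/-- Apostol's Lemma 2 for `c > 0` and every `d`: `Φ(MS) = Φ(M) − 3·sign(d)` (the case `d = 0`
forces `c = 1` and both sides are `a`). [cite: Apostol1990, Supplement to Ch. 3, Lemma 2] -/
private theorem rademacherPhi_mul_S_of_pos {a b c d : ℤ} (hdet : a * d - b * c = 1) (hc : 0 < c) :
    rademacherPhi b (-a) d (-c) = rademacherPhi a b c d - 3 * (Int.sign d : ℚ) := by
  rcases lt_trichotomy 0 d with hd | rfl | hd
  · rw [rademacherPhi_mul_S_of_pos_of_pos hdet hc hd, Int.sign_eq_one_of_pos hd]; push_cast; ring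
  · -- `d = 0`: `-bc = 1`, so `c = 1`
    have hc1 : c = 1 := by
      rcases Int.eq_one_or_neg_one_of_mul_eq_one (show c * (-b) = 1 by linarith) with h | h
      · exact h
      · linarith
    subst hc1
    rw [rademacherPhi_of_c_eq_zero, rademacherPhi_of_c_ne_zero one_ne_zero]
    simp
  · rw [rademacherPhi_mul_S_of_pos_of_neg hdet hc hd, Int.sign_eq_neg_one_of_neg hd]; push_cast; ring

/-- **Apostol's Lemma 2 in terms of `Φ`, all of `SL₂(ℤ)`**: `Φ(MS) = Φ(M) − 3·sign(cd)` for
`M = (a b; c d)`, `ad − bc = 1`, `MS = (b, −a; d, −c)` (`S = (0 −1; 1 0)`).  For `c > 0` this is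
`ε(AS) = e^{−πi/4}ε(A)` (`d > 0`) resp. `e^{πi/4}ε(A)` (`d < 0`) of the source; `c < 0` reduces to
`c > 0` through `Φ(−M) = Φ(M)`, and `c = 0` is immediate. [cite: Apostol1990, Supplement to Ch. 3, Lemma 2] -/
theorem rademacherPhi_mul_S {a b c d : ℤ} (hdet : a * d - b * c = 1) :
    rademacherPhi b (-a) d (-c) = rademacherPhi a b c d - 3 * (Int.sign (c * d) : ℚ) := by
  rcases lt_trichotomy 0 c with hc | rfl | hc
  · rw [rademacherPhi_mul_S_of_pos hdet hc, Int.sign_mul, Int.sign_eq_one_of_pos hc, one_mul]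
  · -- `c = 0`: `ad = 1`
    have had : a * d = 1 := by linarith
    rcases Int.eq_one_or_neg_one_of_mul_eq_one had with rfl | rfl
    · have hd : d = 1 := by linarith
      subst hd
      rw [rademacherPhi_of_c_eq_zero, rademacherPhi_of_c_ne_zero one_ne_zero]
      simp
    · have hd : d = -1 := by linarith
      subst hd
      rw [rademacherPhi_of_c_eq_zero, rademacherPhi_of_c_ne_zero (by norm_num)]
      simp
  · -- `c < 0`: apply the positive case to `-M`
    have h := rademacherPhi_mul_S_of_pos (a := -a) (b := -b) (c := -c) (d := -d)
      (by linear_combination hdet) (by linarith)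
    rw [neg_neg, neg_neg, rademacherPhi_neg, Int.sign_neg] at h
    rw [← rademacherPhi_neg, neg_neg, neg_neg, h, Int.sign_mul, Int.sign_eq_neg_one_of_neg hc]
    push_cast
    ring

/-! ### The sign identity behind the step `M ↦ MS` of the composition law -/

/-- The square of the sign of a nonzero integer is `1`. [folklore] -/
private theorem sign_mul_sign_self {x : ℤ} (hx : x ≠ 0) : Int.sign x * Int.sign x = 1 := by
  rcases hx.lt_or_gt with h | h
  · rw [Int.sign_eq_neg_one_of_neg h]; norm_num
  · rw [Int.sign_eq_one_of_pos h]; norm_num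

/-- Two nonzero integers of the same sign have a sum of that sign. [folklore] -/
private theorem sign_add_of_sign_eq {x y : ℤ} (hx : x ≠ 0) (h : Int.sign x = Int.sign y) :
    Int.sign (x + y) = Int.sign x := by
  rcases hx.lt_or_gt with hx' | hx'
  · rw [Int.sign_eq_neg_one_of_neg hx'] at h ⊢
    have hy : y < 0 := Int.sign_eq_neg_one_iff_neg.mp h.symm
    exact Int.sign_eq_neg_one_of_neg (by omega)
  · rw [Int.sign_eq_one_of_pos hx'] at h ⊢
    have hy : 0 < y := Int.sign_eq_one_iff_pos.mp h.symm
    exact Int.sign_eq_one_of_pos (by omega)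

/-- **The sign identity.** For `M = (a b; c d)` with `ad − bc = 1` and a nonzero row `(c', d')`,
put `(c'', d'') = (c', d')·M = (c'a + d'c, c'b + d'd)`; then
`sign(c·c'·c'') + sign(c''·d'') = sign(c·d) + sign(d·c'·d'')`.  (Key: `c''d − d''c = c'`, so when
`c, c', d''` are nonzero and `sign c = sign(c'd'')`, also `sign d = sign(c'c'')`; otherwise both sides
vanish or the identity is immediate.) [folklore] -/
private theorem sign_identity_of_det {a b c d c' d' : ℤ} (hdet : a * d - b * c = 1)
    (hrow : ¬ (c' = 0 ∧ d' = 0)) :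
    Int.sign (c * c' * (c' * a + d' * c)) + Int.sign ((c' * a + d' * c) * (c' * b + d' * d)) =
      Int.sign (c * d) + Int.sign (d * c' * (c' * b + d' * d)) := by
  set c'' := c' * a + d' * c with hc''
  set d'' := c' * b + d' * d with hd''
  have key : c'' * d - d'' * c = c' := by rw [hc'', hd'']; linear_combination c' * hdet
  simp only [Int.sign_mul]
  by_cases hc' : c' = 0
  · -- `c' = 0`: `c'' = d'c`, `d'' = d'd`, `d' ≠ 0`
    have hd' : d' ≠ 0 := fun h ↦ hrow ⟨hc', h⟩
    have e1 : c'' = d' * c := by rw [hc'', hc']; ring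
    have e2 : d'' = d' * d := by rw [hd'', hc']; ring
    rw [e1, e2, hc', Int.sign_zero, Int.sign_mul, Int.sign_mul]
    linear_combination (Int.sign c * Int.sign d) * sign_mul_sign_self hd'
  by_cases hd''0 : d'' = 0
  · -- `d'' = 0`: then `c'' d = c'`, so `sign c'' · sign d = sign c'`
    rw [hd''0, Int.sign_zero]
    have hk : c'' * d = c' := by rw [← key, hd''0]; ring
    have hsd : Int.sign c'' * Int.sign d = Int.sign c' := by rw [← Int.sign_mul, hk]
    have hc''0 : c'' ≠ 0 := by rintro h; rw [h, zero_mul] at hk; exact hc' hk.symm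
    linear_combination (-(Int.sign c * Int.sign c'')) * hsd
      + (Int.sign c * Int.sign d) * sign_mul_sign_self hc''0
  by_cases hc0 : c = 0
  · -- `c = 0`: `ad = 1`, `c'' d = c'`
    have hk : c'' * d = c' := by rw [← key, hc0]; ring
    have hsd : Int.sign c'' * Int.sign d = Int.sign c' := by rw [← Int.sign_mul, hk]
    have hd0 : d ≠ 0 := by rintro h; rw [h, mul_zero] at hk; exact hc' hk.symm
    rw [hc0, Int.sign_zero]
    linear_combination (Int.sign d * Int.sign d'') * hsd
      - (Int.sign c'' * Int.sign d'') * sign_mul_sign_self hd0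
  -- main case: `c, c', d''` nonzero
  by_cases huv : Int.sign c = Int.sign c' * Int.sign d''
  · -- then `sign(d''c) = sign c'`, so `c' + d''c` has the sign of `c'`, i.e. `sign(c''d) = sign c'`
    have h1 : Int.sign (d'' * c) = Int.sign c' := by
      rw [Int.sign_mul, huv]; linear_combination Int.sign c' * sign_mul_sign_self hd''0
    have h2 : Int.sign (c' + d'' * c) = Int.sign c' := sign_add_of_sign_eq hc' h1.symm
    have h3 : Int.sign c'' * Int.sign d = Int.sign c' := by
      rw [← Int.sign_mul, show c'' * d = c' + d'' * c from by rw [← key]; ring, h2]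
    have hd0 : d ≠ 0 := by
      rintro rfl
      rw [Int.sign_zero, mul_zero] at h3
      exact hc' (Int.sign_eq_zero_iff_zero.mp h3.symm)
    have hc''0 : c'' ≠ 0 := by
      rintro h
      rw [h, Int.sign_zero, zero_mul] at h3
      exact hc' (Int.sign_eq_zero_iff_zero.mp h3.symm)
    have h4 : Int.sign d = Int.sign c' * Int.sign c'' := by
      linear_combination Int.sign c'' * h3 - Int.sign d * sign_mul_sign_self hc''0
    rw [huv, h4]
    linear_combination (-(Int.sign c'' * Int.sign d'')) * sign_mul_sign_self hc'
  · -- otherwise `sign c = −sign c'·sign d''` and both sides vanish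
    have hu : Int.sign c = 1 ∨ Int.sign c = -1 := by
      rcases (Ne.lt_or_gt hc0) with h | h
      · exact Or.inr (Int.sign_eq_neg_one_of_neg h)
      · exact Or.inl (Int.sign_eq_one_of_pos h)
    have hv : Int.sign c' * Int.sign d'' = 1 ∨ Int.sign c' * Int.sign d'' = -1 := by
      rw [← Int.sign_mul]
      rcases (Ne.lt_or_gt (mul_ne_zero hc' hd''0)) with h | h
      · exact Or.inr (Int.sign_eq_neg_one_of_neg h)
      · exact Or.inl (Int.sign_eq_one_of_pos h)
    have hneg : Int.sign c = -(Int.sign c' * Int.sign d'') := by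
      rcases hu with hu | hu <;> rcases hv with hv | hv
      · exact absurd (hu.trans hv.symm) huv
      · norm_num [hu, hv]
      · norm_num [hu, hv]
      · exact absurd (hu.trans hv.symm) huv
    rw [hneg]
    linear_combination (-(Int.sign c'' * Int.sign d'')) * sign_mul_sign_self hc'

/-! ### `Φ` on `SL(2, ℤ)`: the generator steps -/

/-- The determinant of `M ∈ SL₂(ℤ)` in terms of its entries. [folklore] -/
private theorem sl_det (M : SL(2, ℤ)) : M 0 0 * M 1 1 - M 0 1 * M 1 0 = 1 := by
  have h := Matrix.det_fin_two (M : Matrix (Fin 2) (Fin 2) ℤ)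
  rw [M.det_coe] at h
  linarith

/-- Entries of `MT`. [folklore] -/
private theorem sl_mul_T (M : SL(2, ℤ)) :
    (M * ModularGroup.T) 0 0 = M 0 0 ∧ (M * ModularGroup.T) 0 1 = M 0 0 + M 0 1 ∧
      (M * ModularGroup.T) 1 0 = M 1 0 ∧ (M * ModularGroup.T) 1 1 = M 1 0 + M 1 1 := by
  simp [Matrix.mul_apply, Fin.sum_univ_two, ModularGroup.coe_T]

/-- Entries of `MT⁻¹`. [folklore] -/
private theorem sl_mul_T_inv (M : SL(2, ℤ)) :
    (M * ModularGroup.T⁻¹) 0 0 = M 0 0 ∧ (M * ModularGroup.T⁻¹) 0 1 = M 0 1 - M 0 0 ∧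
      (M * ModularGroup.T⁻¹) 1 0 = M 1 0 ∧ (M * ModularGroup.T⁻¹) 1 1 = M 1 1 - M 1 0 := by
  simp only [Matrix.SpecialLinearGroup.coe_mul, ModularGroup.coe_T_inv, Matrix.mul_apply,
    Fin.sum_univ_two]
  simp
  constructor <;> ring

/-- Entries of `MS`. [folklore] -/
private theorem sl_mul_S (M : SL(2, ℤ)) :
    (M * ModularGroup.S) 0 0 = M 0 1 ∧ (M * ModularGroup.S) 0 1 = -M 0 0 ∧
      (M * ModularGroup.S) 1 0 = M 1 1 ∧ (M * ModularGroup.S) 1 1 = -M 1 0 := by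
  simp [Matrix.mul_apply, Fin.sum_univ_two, ModularGroup.coe_S]

/-- Entries of `-M`. [folklore] -/
private theorem sl_neg_apply (M : SL(2, ℤ)) (i j : Fin 2) : (-M) i j = -(M i j) := by simp

/-- Lower row of a product. [folklore] -/
private theorem sl_mul_apply_10 (A B : SL(2, ℤ)) : (A * B) 1 0 = A 1 0 * B 0 0 + A 1 1 * B 1 0 := by
  simp [Matrix.mul_apply, Fin.sum_univ_two]

/-- Lower row of a product. [folklore] -/
private theorem sl_mul_apply_11 (A B : SL(2, ℤ)) : (A * B) 1 1 = A 1 0 * B 0 1 + A 1 1 * B 1 1 := by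
  simp [Matrix.mul_apply, Fin.sum_univ_two]

/-- `Φ(−M) = Φ(M)` on `SL(2, ℤ)`. [cite: RademacherGrosswald1972, Ch. 4 A, eq. (59)] -/
theorem rademacherPhiSL_neg (M : SL(2, ℤ)) : rademacherPhiSL (-M) = rademacherPhiSL M := by
  rw [rademacherPhiSL_apply, rademacherPhiSL_apply, sl_neg_apply, sl_neg_apply, sl_neg_apply,
    sl_neg_apply, rademacherPhi_neg]

/-- `Φ(MT) = Φ(M) + 1` on `SL(2, ℤ)`. [cite: Apostol1990, Supplement to Ch. 3, Lemma 1] -/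
theorem rademacherPhiSL_mul_T (M : SL(2, ℤ)) :
    rademacherPhiSL (M * ModularGroup.T) = rademacherPhiSL M + 1 := by
  obtain ⟨h00, h01, h10, h11⟩ := sl_mul_T M
  rw [rademacherPhiSL_apply, rademacherPhiSL_apply, h00, h01, h10, h11,
    rademacherPhi_mul_T (sl_det M)]

/-- `Φ(MT⁻¹) = Φ(M) − 1` on `SL(2, ℤ)`. [cite: Apostol1990, Supplement to Ch. 3, Lemma 1] -/
theorem rademacherPhiSL_mul_T_inv (M : SL(2, ℤ)) :
    rademacherPhiSL (M * ModularGroup.T⁻¹) = rademacherPhiSL M - 1 := by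
  obtain ⟨h00, h01, h10, h11⟩ := sl_mul_T_inv M
  rw [rademacherPhiSL_apply, rademacherPhiSL_apply, h00, h01, h10, h11,
    rademacherPhi_mul_T_inv (sl_det M)]

/-- **`Φ(MS) = Φ(M) − 3·sign(cd)`** on `SL(2, ℤ)`, `S = (0 −1; 1 0)`.
[cite: Apostol1990, Supplement to Ch. 3, Lemma 2] -/
theorem rademacherPhiSL_mul_S (M : SL(2, ℤ)) :
    rademacherPhiSL (M * ModularGroup.S) = rademacherPhiSL M - 3 * (Int.sign (M 1 0 * M 1 1) : ℚ) := by
  obtain ⟨h00, h01, h10, h11⟩ := sl_mul_S M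
  rw [rademacherPhiSL_apply, rademacherPhiSL_apply, h00, h01, h10, h11,
    rademacherPhi_mul_S (sl_det M)]

/-- `Φ(M(−S)) = Φ(MS)` and `S⁻¹ = −S`: the step `M ↦ MS⁻¹` has the same shape as `M ↦ MS`.
[folklore] -/
private theorem modular_S_inv : (ModularGroup.S : SL(2, ℤ))⁻¹ = -ModularGroup.S := by
  ext i j
  fin_cases i <;> fin_cases j <;>
    simp [ModularGroup.S, Matrix.SpecialLinearGroup.coe_inv, Matrix.adjugate_fin_two]

/-! ### The composition law -/

/-- The step `M ↦ MS` of the composition law. [cite: RademacherGrosswald1972, Ch. 4 A, eq. (62)] -/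
private theorem comp_step_S (M' x : SL(2, ℤ))
    (ih : rademacherPhiSL (M' * x) = rademacherPhiSL M' + rademacherPhiSL x -
      3 * (Int.sign (x 1 0 * M' 1 0 * (M' * x) 1 0) : ℚ)) :
    rademacherPhiSL (M' * (x * ModularGroup.S)) =
      rademacherPhiSL M' + rademacherPhiSL (x * ModularGroup.S) -
        3 * (Int.sign ((x * ModularGroup.S) 1 0 * M' 1 0 * (M' * (x * ModularGroup.S)) 1 0) : ℚ) := by
  obtain ⟨-, -, hx10, -⟩ := sl_mul_S x
  obtain ⟨-, -, hMx10, -⟩ := sl_mul_S (M' * x)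
  rw [← mul_assoc, rademacherPhiSL_mul_S, rademacherPhiSL_mul_S, ih, hx10, hMx10,
    sl_mul_apply_10, sl_mul_apply_11]
  have hrow : ¬ (M' 1 0 = 0 ∧ M' 1 1 = 0) := by
    rintro ⟨h0, h1⟩
    have := sl_det M'
    rw [h0, h1, mul_zero, mul_zero, sub_zero] at this
    exact zero_ne_one this
  have key := sign_identity_of_det (c' := M' 1 0) (d' := M' 1 1) (sl_det x) hrow
  have key' : ((Int.sign (x 1 0 * M' 1 0 * (M' 1 0 * x 0 0 + M' 1 1 * x 1 0)) : ℤ) : ℚ) +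
      (Int.sign ((M' 1 0 * x 0 0 + M' 1 1 * x 1 0) * (M' 1 0 * x 0 1 + M' 1 1 * x 1 1)) : ℚ) =
      (Int.sign (x 1 0 * x 1 1) : ℚ) +
        (Int.sign (x 1 1 * M' 1 0 * (M' 1 0 * x 0 1 + M' 1 1 * x 1 1)) : ℚ) := by
    exact_mod_cast key
  linear_combination (-3 : ℚ) * key'

/-- **The composition law for Rademacher's `Φ` (proved):** for `M, M' ∈ SL₂(ℤ)` with lower-left
entries `c, c'` and `c''` that of `M'M`, `Φ(M'M) = Φ(M') + Φ(M) − 3·sign(c c' c'')`.  Discharges the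
named statement `RademacherPhiComposition`.  Proof: induction on `M` over words in `S`, `T` (the
printed proof is analytic, via `log η`). [cite: RademacherGrosswald1972, Ch. 4 A, eq. (62)] -/
theorem RademacherPhiComposition_holds : RademacherPhiComposition := by
  intro M M'
  have hM : M ∈ Subgroup.closure ({ModularGroup.S, ModularGroup.T} : Set SL(2, ℤ)) := by
    rw [SpecialLinearGroup.SL2Z_generators]; trivial
  induction hM using Subgroup.closure_induction_right with
  | one => simp
  | mul_right x hx y hy ih =>
    rcases hy with rfl | rfl
    · exact comp_step_S M' x ih
    · obtain ⟨-, -, hx10, -⟩ := sl_mul_T x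
      obtain ⟨-, -, hMx10, -⟩ := sl_mul_T (M' * x)
      rw [← mul_assoc, rademacherPhiSL_mul_T, rademacherPhiSL_mul_T, ih, hx10, hMx10]
      ring
  | mul_inv_cancel x hx y hy ih =>
    rcases hy with rfl | rfl
    · -- `x S⁻¹ = -(x S)`
      have h := comp_step_S M' x ih
      obtain ⟨-, -, hx10, -⟩ := sl_mul_S x
      rw [modular_S_inv, mul_neg, mul_neg, rademacherPhiSL_neg, rademacherPhiSL_neg, sl_neg_apply,
        sl_neg_apply, h]
      congr 3
      ring
    · obtain ⟨-, -, hx10, -⟩ := sl_mul_T_inv x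
      obtain ⟨-, -, hMx10, -⟩ := sl_mul_T_inv (M' * x)
      rw [← mul_assoc, rademacherPhiSL_mul_T_inv, rademacherPhiSL_mul_T_inv, ih, hx10, hMx10]
      ring

/-- The composition law, explicit form. [cite: RademacherGrosswald1972, Ch. 4 A, eq. (62)] -/
theorem rademacherPhiSL_mul (M' M : SL(2, ℤ)) :
    rademacherPhiSL (M' * M) =
      rademacherPhiSL M' + rademacherPhiSL M - 3 * (Int.sign (M 1 0 * M' 1 0 * (M' * M) 1 0) : ℚ) :=
  RademacherPhiComposition_holds M M'

/-! ### Hypothesis-free consequences: `Ψ_t` is a homomorphism on `Γ₀(t)` -/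

/-- **`Ψ_t` is additive on `Γ₀(t)`** (hypothesis-free form of `eisensteinPsiSL_mul`).
[cite: RademacherGrosswald1972, Ch. 4 A, eq. (59)–(62)] -/
theorem eisensteinPsiSL_mul' {t : ℕ} (ht : 0 < t) {A B : SL(2, ℤ)}
    (hA : (t : ℤ) ∣ A 1 0) (hB : (t : ℤ) ∣ B 1 0) :
    eisensteinPsiSL t (A * B) = eisensteinPsiSL t A + eisensteinPsiSL t B :=
  eisensteinPsiSL_mul RademacherPhiComposition_holds ht hA hB

/-- **`Ψ_t` is additive on `Γ₀(t)`**, membership form (hypothesis-free form of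
`eisensteinPsiSL_mul_of_mem_Gamma0`). [cite: RademacherGrosswald1972, Ch. 4 A, eq. (59)–(62)] -/
theorem eisensteinPsiSL_mul_of_mem_Gamma0' {t : ℕ} (ht : 0 < t) {A B : SL(2, ℤ)}
    (hA : A ∈ CongruenceSubgroup.Gamma0 t) (hB : B ∈ CongruenceSubgroup.Gamma0 t) :
    eisensteinPsiSL t (A * B) = eisensteinPsiSL t A + eisensteinPsiSL t B :=
  eisensteinPsiSL_mul_of_mem_Gamma0 RademacherPhiComposition_holds ht hA hB

end Literature.NumberTheory.ModularForms
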